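import Literature.NumberTheory.GaloisRepresentations.ContinuousShapiroOpenCoinducedDescent
import HarnessLib

/-!
# Continuous cohomology commutes with finite products, naturally in matrices of morphisms
# (Serre, *Cohomologie galoisienne* I §2.2; NSW (1.3.4))

Topic `NumberTheory/GaloisRepresentations` (continuous cochain cohomology); namespace
`Literature.NumberTheory.GaloisRepresentations` (dot notation under `ContinuousRep`).  Definitions
with bodies and theorems; no named fact, no `sorry`, no instance, no notation.

For a topological group `Γ`, a continuous representation `ρ` of `Γ` on a DISCRETE `M` and a FINITE
index type `ι`, the componentwise representation `ρ.piConst ι` on `ι → M` has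

  **`Hⁿ(Γ, ι → M) ≃+ (ι → Hⁿ(Γ, M))`**   (`ρ.piCohomologyEquiv ι n`),

`x ↦ (i ↦ Hⁿ(prᵢ) x)`, inverse `f ↦ Σᵢ Hⁿ(inᵢ) (f i)` — not by homological algebra but by the
ADDITIVITY of `Hⁿ(Γ, –)` in the morphism (`cohomologyMap_comp_apply_of_sum` of
`ContinuousShapiroOpenCoinducedDescent`: `Σᵢ inᵢ ∘ prᵢ = id`, `prⱼ ∘ inᵢ = δᵢⱼ`).  NATURALITY
(`piCohomologyEquiv_matrix`): for `Γ`-morphisms `a i j : M → M′` the matrix morphism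
`T : (ι → M) → (κ → M′)`, `(T φ) i = Σ_j a i j (φ j)` (`ContinuousRep.piMatrix`), induces on cohomology
the matrix `(Hⁿ(a i j))`: `Hⁿ(pr_i) (Hⁿ(T) x) = Σ_j Hⁿ(a i j) (Hⁿ(pr_j) x)`.

Use (lane «TATE-EPC-TC», cell `bsd-eis`, stmt-BirchSwinnertonDyer-19032, brick B8-alg): a finite
free trivial module `M₀ ≅ 𝔽_p^d` with a `Δ`-action by matrices is absorbed into coefficients,
`Hⁿ(Γ, X ⊗ M₀) ≅ Hⁿ(Γ, X) ⊗ M₀` as `Δ`-modules (Milne ADT I Lemma 5.4 (a)).  HONEST FRAMING: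
homological bookkeeping only; no arithmetic statement and no case of BSD is proved here.

## References
* J.-P. Serre, *Cohomologie galoisienne* (1994), I §2.2. [SerreGaloisCohomology1997]
* J. Neukirch, A. Schmidt, K. Wingberg, *Cohomology of Number Fields*, 2nd ed. (2008), (1.3.4)
  (cohomology commutes with products). [NeukirchSchmidtWingberg2008]
* J. S. Milne, *Arithmetic Duality Theorems*, 2nd ed. (2006), I Lemma 5.4 (a). [MilneADT2006]
-/

noncomputable section

open CategoryTheory Function
open scoped Topology

universe u w

namespace Literature.NumberTheory.GaloisRepresentations

open _root_.TopRep _root_.ContRepresentation _root_.ContinuousCohomology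

/-! ## §0 Two more additivity lemmas (composites given as pairs, no `≫` in hypotheses) -/

section Additivity

variable {k : Type w} [Ring k] [TopologicalSpace k]
variable {G : Type u} [Group G] [TopologicalSpace G] [IsTopologicalGroup G]
variable {A B B' C : TopRep.{u} k G}

/-- If `g ∘ f = Σ_i F₂ i ∘ F₁ i` pointwise then `Hⁿ(g) (Hⁿ(f) x) = Σ_i Hⁿ(F₂ i) (Hⁿ(F₁ i) x)`.
[cite: SerreGaloisCohomology1997, I §2.2] -/
theorem cohomologyMap_comp_apply_of_sum_comp {ι : Type*} (f : A ⟶ B) (g : B ⟶ C) (s : Finset ι)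
    (F₁ : ι → (A ⟶ B')) (F₂ : ι → (B' ⟶ C))
    (hh : ∀ v : A, g.hom (f.hom v) = ∑ i ∈ s, (F₂ i).hom ((F₁ i).hom v)) (n : ℕ)
    (x : continuousCohomology n A) :
    cohomologyMap g n (cohomologyMap f n x) = ∑ i ∈ s, cohomologyMap (F₂ i) n (cohomologyMap (F₁ i) n x) := by
  rw [cohomologyMap_comp_apply_of_sum f g s (fun i => F₁ i ≫ F₂ i) (fun v => hh v) n x]
  exact Finset.sum_congr rfl fun i _ =>
    (cohomologyMap_comp_apply_of_eq (F₁ i) (F₂ i) (F₁ i ≫ F₂ i) (fun _ => rfl) n x).symm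

/-- If `id = Σ_i F₂ i ∘ F₁ i` pointwise then `x = Σ_i Hⁿ(F₂ i) (Hⁿ(F₁ i) x)`.
[cite: SerreGaloisCohomology1997, I §2.2] -/
theorem eq_sum_cohomologyMap_of_sum_comp {ι : Type*} (s : Finset ι) (F₁ : ι → (A ⟶ B')) (F₂ : ι → (B' ⟶ A))
    (hh : ∀ v : A, v = ∑ i ∈ s, (F₂ i).hom ((F₁ i).hom v)) (n : ℕ) (x : continuousCohomology n A) :
    x = ∑ i ∈ s, cohomologyMap (F₂ i) n (cohomologyMap (F₁ i) n x) := by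
  have h := cohomologyMap_comp_apply_of_sum_comp (𝟙 A) (𝟙 A) s F₁ F₂ (fun v => hh v) n x
  rwa [cohomologyMap_id_apply, cohomologyMap_id_apply] at h

end Additivity

namespace ContinuousRep

/-! ## §1 The componentwise representation on `ι → M`, projections, injections, matrices -/

section Pi

variable {G : Type u} [Group G] [TopologicalSpace G]
variable {M : Type u} [AddCommGroup M] [TopologicalSpace M] [DiscreteTopology M]
variable {M' : Type u} [AddCommGroup M'] [TopologicalSpace M'] [DiscreteTopology M']
variable (ρ : ContinuousRep G ℤ M) (ρ' : ContinuousRep G ℤ M') (ι κ : Type)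

/-- **The componentwise representation on `ι → M`**: `(g φ) i = g (φ i)` (product topology).
[cite: NeukirchSchmidtWingberg2008, (1.3.4)] -/
def piConst : ContinuousRep G ℤ (ι → M) where
  toRepresentation :=
    { toFun := fun g => LinearMap.pi fun i => (ρ g).comp (LinearMap.proj i)
      map_one' := by ext φ i; simp
      map_mul' := fun g h => by ext φ i; simp }
  continuous_smul := continuous_pi fun i =>
    ρ.continuous_smul.comp (continuous_fst.prodMk ((_root_.continuous_apply i).comp continuous_snd))

omit [DiscreteTopology M] in
/-- Formula: `(ρ.piConst ι g φ) i = ρ g (φ i)`. [cite: NeukirchSchmidtWingberg2008, (1.3.4)] -/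
@[simp] theorem piConst_apply (g : G) (φ : ι → M) (i : ι) : ρ.piConst ι g φ i = ρ g (φ i) := rfl

/-- **The projection `pr_i : (ι → M) → M`** as a morphism of topological representations.
[cite: NeukirchSchmidtWingberg2008, (1.3.4)] -/
def piProj (i : ι) : (ρ.piConst ι).toTopRep ⟶ ρ.toTopRep :=
  TopRep.ofHom
    { toLinearMap := LinearMap.proj i
      cont := _root_.continuous_apply i
      isIntertwining' := fun _ => rfl }

/-- Formula: `pr_i φ = φ i`. [cite: NeukirchSchmidtWingberg2008, (1.3.4)] -/
@[simp] theorem piProj_apply (i : ι) (φ : ι → M) : (ρ.piProj ι i).hom φ = φ i := rfl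

/-- **The matrix morphism** `T : (ι → M) → (κ → M′)`, `(T φ) i = Σ_j a i j (φ j)`, for a matrix of
`Γ`-morphisms `a i j : M → M′` (`ι` finite). [cite: NeukirchSchmidtWingberg2008, (1.3.4)] -/
def piMatrix [Fintype ι] (a : κ → ι → (ρ.toTopRep ⟶ ρ'.toTopRep)) :
    (ρ.piConst ι).toTopRep ⟶ (ρ'.piConst κ).toTopRep :=
  haveI : DiscreteTopology (ι → M) := Pi.discreteTopology
  TopRep.ofHom
    { toLinearMap :=
        { toFun := fun φ i => ∑ j : ι, (a i j).hom (φ j)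
          map_add' := fun φ ψ => funext fun i => by
            change ∑ j, (a i j).hom (φ j + ψ j) = (∑ j, (a i j).hom (φ j)) + ∑ j, (a i j).hom (ψ j)
            rw [← Finset.sum_add_distrib]
            exact Finset.sum_congr rfl fun j _ => map_add _ _ _
          map_smul' := fun c φ => funext fun i => by
            change ∑ j, (a i j).hom (c • φ j) = c • ∑ j, (a i j).hom (φ j)
            rw [Finset.smul_sum]
            exact Finset.sum_congr rfl fun j _ => map_zsmul _ _ _ }
      cont := continuous_of_discreteTopology
      isIntertwining' := fun g => by
        ext φ i
        change ∑ j, (a i j).hom (ρ g (φ j)) = ρ' g (∑ j, (a i j).hom (φ j))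
        rw [map_sum]
        exact Finset.sum_congr rfl fun j _ => TopRep.hom_comm_apply (a i j) g (φ j) }

/-- Formula: `(piMatrix a φ) i = Σ_j a i j (φ j)`. [cite: NeukirchSchmidtWingberg2008, (1.3.4)] -/
@[simp] theorem piMatrix_apply [Fintype ι] (a : κ → ι → (ρ.toTopRep ⟶ ρ'.toTopRep)) (φ : ι → M) (i : κ) :
    (ρ.piMatrix ρ' ι κ a).hom φ i = ∑ j : ι, (a i j).hom (φ j) := rfl

variable [DecidableEq ι]

/-- **The injection `in_i : M → (ι → M)`** (`m` in slot `i`, `0` elsewhere) as a morphism of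
topological representations. [cite: NeukirchSchmidtWingberg2008, (1.3.4)] -/
def piIncl (i : ι) : ρ.toTopRep ⟶ (ρ.piConst ι).toTopRep :=
  TopRep.ofHom
    { toLinearMap := LinearMap.single ℤ (fun _ : ι => M) i
      cont := continuous_of_discreteTopology
      isIntertwining' := fun g => by
        ext m j
        change Pi.single (M := fun _ => M) i (ρ g m) j = ρ g (Pi.single (M := fun _ => M) i m j)
        by_cases h : j = i
        · subst h; simp
        · simp [h] }

/-- Formula: `in_i m = Pi.single i m`. [cite: NeukirchSchmidtWingberg2008, (1.3.4)] -/
@[simp] theorem piIncl_apply (i : ι) (m : M) : (ρ.piIncl ι i).hom m = Pi.single (M := fun _ => M) i m := rfl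

/-- `pr_i ∘ in_i = id`. [cite: NeukirchSchmidtWingberg2008, (1.3.4)] -/
theorem piProj_piIncl_same (i : ι) (m : M) : (ρ.piProj ι i).hom ((ρ.piIncl ι i).hom m) = m := by
  rw [piIncl_apply, piProj_apply, Pi.single_eq_same]

/-- `pr_j ∘ in_i = 0` for `j ≠ i`. [cite: NeukirchSchmidtWingberg2008, (1.3.4)] -/
theorem piProj_piIncl_ne {i j : ι} (h : j ≠ i) (m : M) : (ρ.piProj ι j).hom ((ρ.piIncl ι i).hom m) = 0 := by
  rw [piIncl_apply, piProj_apply, Pi.single_eq_of_ne h]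

/-- `φ = Σ_i in_i (pr_i φ)` (`ι` finite). [cite: NeukirchSchmidtWingberg2008, (1.3.4)] -/
theorem eq_sum_piIncl_piProj [Fintype ι] (φ : ι → M) :
    φ = ∑ i : ι, (ρ.piIncl ι i).hom ((ρ.piProj ι i).hom φ) :=
  (Finset.univ_sum_single φ).symm

end Pi

/-! ## §2 `Hⁿ(Γ, ι → M) ≃+ (ι → Hⁿ(Γ, M))` -/

section Cohomology

variable {G : Type u} [Group G] [TopologicalSpace G] [IsTopologicalGroup G]
variable {M : Type u} [AddCommGroup M] [TopologicalSpace M] [DiscreteTopology M]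
variable {M' : Type u} [AddCommGroup M'] [TopologicalSpace M'] [DiscreteTopology M']
variable (ρ : ContinuousRep G ℤ M) (ρ' : ContinuousRep G ℤ M') (ι κ : Type) [Fintype ι] [Fintype κ]
  [DecidableEq ι] [DecidableEq κ]

omit [Fintype ι] in
/-- `Hⁿ(pr_i) (Hⁿ(in_i) x) = x`. [cite: NeukirchSchmidtWingberg2008, (1.3.4)] -/
theorem cohomologyMap_piProj_piIncl_same (n : ℕ) (i : ι) (x : continuousCohomology n ρ.toTopRep) :
    cohomologyMap (ρ.piProj ι i) n (cohomologyMap (ρ.piIncl ι i) n x) = x :=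
  cohomologyMap_comp_apply_of_nsmul (ρ.piIncl ι i) (ρ.piProj ι i) 1
    (fun m => by rw [one_smul]; exact ρ.piProj_piIncl_same ι i m) n x |>.trans (one_smul _ _)

omit [Fintype ι] in
/-- `Hⁿ(pr_j) (Hⁿ(in_i) x) = 0` for `j ≠ i`. [cite: NeukirchSchmidtWingberg2008, (1.3.4)] -/
theorem cohomologyMap_piProj_piIncl_ne (n : ℕ) {i j : ι} (h : j ≠ i)
    (x : continuousCohomology n ρ.toTopRep) :
    cohomologyMap (ρ.piProj ι j) n (cohomologyMap (ρ.piIncl ι i) n x) = 0 :=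
  cohomologyMap_comp_apply_of_zero (ρ.piIncl ι i) (ρ.piProj ι j) (fun m => ρ.piProj_piIncl_ne ι h m) n x

/-- `x = Σ_i Hⁿ(in_i) (Hⁿ(pr_i) x)`. [cite: NeukirchSchmidtWingberg2008, (1.3.4)] -/
theorem eq_sum_cohomologyMap_piIncl_piProj (n : ℕ) (x : continuousCohomology n (ρ.piConst ι).toTopRep) :
    x = ∑ i : ι, cohomologyMap (ρ.piIncl ι i) n (cohomologyMap (ρ.piProj ι i) n x) :=
  eq_sum_cohomologyMap_of_sum_comp (Finset.univ : Finset ι) (fun i => ρ.piProj ι i)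
    (fun i => ρ.piIncl ι i) (fun φ => ρ.eq_sum_piIncl_piProj ι φ) n x

/-- `Hⁿ(pr_j) (Σ_i Hⁿ(in_i) (f i)) = f j`. [cite: NeukirchSchmidtWingberg2008, (1.3.4)] -/
theorem cohomologyMap_piProj_sum_piIncl (n : ℕ) (f : ι → continuousCohomology n ρ.toTopRep) (j : ι) :
    cohomologyMap (ρ.piProj ι j) n (∑ i : ι, cohomologyMap (ρ.piIncl ι i) n (f i)) = f j := by
  rw [map_sum, Finset.sum_eq_single j (fun i _ hij => ρ.cohomologyMap_piProj_piIncl_ne ι n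
    (Ne.symm hij) (f i)) (fun h => (h (Finset.mem_univ j)).elim), cohomologyMap_piProj_piIncl_same]

/-- **`Hⁿ(Γ, ι → M) ≃+ (ι → Hⁿ(Γ, M))`**, `x ↦ (i ↦ Hⁿ(pr_i) x)`, inverse `f ↦ Σ_i Hⁿ(in_i) (f i)`
(finite `ι`; additivity of `Hⁿ(Γ, –)` in the morphism). [cite: NeukirchSchmidtWingberg2008, (1.3.4)]
[cite: SerreGaloisCohomology1997, I §2.2] -/
def piCohomologyEquiv (n : ℕ) :
    (continuousCohomology n (ρ.piConst ι).toTopRep : Type u) ≃+ (ι → (continuousCohomology n ρ.toTopRep : Type u)) where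
  toFun x i := cohomologyMap (ρ.piProj ι i) n x
  invFun f := ∑ i : ι, cohomologyMap (ρ.piIncl ι i) n (f i)
  left_inv x := (ρ.eq_sum_cohomologyMap_piIncl_piProj ι n x).symm
  right_inv f := funext fun j => ρ.cohomologyMap_piProj_sum_piIncl ι n f j
  map_add' _ _ := funext fun _ => map_add _ _ _

/-- Formula: `piCohomologyEquiv x i = Hⁿ(pr_i) x`. [cite: NeukirchSchmidtWingberg2008, (1.3.4)] -/
@[simp] theorem piCohomologyEquiv_apply (n : ℕ) (x : continuousCohomology n (ρ.piConst ι).toTopRep) (i : ι) :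
    ρ.piCohomologyEquiv ι n x i = cohomologyMap (ρ.piProj ι i) n x := rfl

/-- Formula for the inverse: `piCohomologyEquiv⁻¹ f = Σ_i Hⁿ(in_i) (f i)`. [cite: NeukirchSchmidtWingberg2008, (1.3.4)] -/
theorem piCohomologyEquiv_symm_apply (n : ℕ) (f : ι → continuousCohomology n ρ.toTopRep) :
    (ρ.piCohomologyEquiv ι n).symm f = ∑ i : ι, cohomologyMap (ρ.piIncl ι i) n (f i) := rfl

/-- `#Hⁿ(Γ, ι → M) = #Hⁿ(Γ, M) ^ #ι`. [cite: NeukirchSchmidtWingberg2008, (1.3.4)] -/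
theorem natCard_continuousCohomology_piConst (n : ℕ) :
    Nat.card (continuousCohomology n (ρ.piConst ι).toTopRep) =
      Nat.card (continuousCohomology n ρ.toTopRep) ^ Fintype.card ι := by
  rw [Nat.card_congr (ρ.piCohomologyEquiv ι n).toEquiv, Nat.card_fun, Nat.card_eq_fintype_card (α := ι)]

/-! ## §3 Naturality in matrices of morphisms -/

/-- **The matrix morphism induces the matrix of `Hⁿ`'s**: `Hⁿ(pr_i) (Hⁿ(T) x) = Σ_j Hⁿ(a i j) (Hⁿ(pr_j) x)`
for `(T φ) i = Σ_j a i j (φ j)` (additivity: `pr_i ∘ T = Σ_j a i j ∘ pr_j`).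
[cite: NeukirchSchmidtWingberg2008, (1.3.4)] [cite: MilneADT2006, I Lemma 5.4 (a)] -/
theorem piCohomologyEquiv_matrix (a : κ → ι → (ρ.toTopRep ⟶ ρ'.toTopRep)) (n : ℕ)
    (x : continuousCohomology n (ρ.piConst ι).toTopRep) (i : κ) :
    ρ'.piCohomologyEquiv κ n (cohomologyMap (ρ.piMatrix ρ' ι κ a) n x) i =
      ∑ j : ι, cohomologyMap (a i j) n (ρ.piCohomologyEquiv ι n x j) := by
  rw [piCohomologyEquiv_apply]
  exact cohomologyMap_comp_apply_of_sum_comp (ρ.piMatrix ρ' ι κ a) (ρ'.piProj κ i)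
    (Finset.univ : Finset ι) (fun j => ρ.piProj ι j) (fun j => a i j) (fun φ => rfl) n x

/-- Matrix form on the inverse: `Hⁿ(T) (piCohomologyEquiv⁻¹ f) = piCohomologyEquiv⁻¹ (A f)` with
`(A f) i = Σ_j Hⁿ(a i j) (f j)`. [cite: NeukirchSchmidtWingberg2008, (1.3.4)] -/
theorem cohomologyMap_piMatrix_symm (a : κ → ι → (ρ.toTopRep ⟶ ρ'.toTopRep)) (n : ℕ)
    (f : ι → continuousCohomology n ρ.toTopRep) :
    cohomologyMap (ρ.piMatrix ρ' ι κ a) n ((ρ.piCohomologyEquiv ι n).symm f) =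
      (ρ'.piCohomologyEquiv κ n).symm fun i => ∑ j : ι, cohomologyMap (a i j) n (f j) := by
  apply (ρ'.piCohomologyEquiv κ n).injective
  rw [AddEquiv.apply_symm_apply]
  funext i
  rw [piCohomologyEquiv_matrix]
  exact Finset.sum_congr rfl fun j _ => by rw [AddEquiv.apply_symm_apply]

/-- The DIAGONAL case: `Hⁿ` of `φ ↦ (i ↦ f (φ i))` is `Hⁿ(f)` componentwise.
[cite: NeukirchSchmidtWingberg2008, (1.3.4)] -/
theorem piCohomologyEquiv_diagonal (f : ρ.toTopRep ⟶ ρ'.toTopRep) (n : ℕ)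
    (x : continuousCohomology n (ρ.piConst ι).toTopRep) (i : ι) :
    ρ'.piCohomologyEquiv ι n (cohomologyMap (ρ.piMatrix ρ' ι ι fun i j => if i = j then f else 0) n x) i =
      cohomologyMap f n (ρ.piCohomologyEquiv ι n x i) := by
  rw [piCohomologyEquiv_matrix, Finset.sum_eq_single i (fun j _ hji => by
    rw [if_neg (Ne.symm hji)]
    exact cohomologyMap_comp_apply_of_zero (ρ.piProj ι j) (0 : ρ.toTopRep ⟶ ρ'.toTopRep)
      (fun _ => rfl) n x) (fun h => (h (Finset.mem_univ i)).elim), if_pos rfl]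

end Cohomology

end ContinuousRep

end Literature.NumberTheory.GaloisRepresentations

end
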